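import Summits.BirchSwinnertonDyer.BirchSwinnertonDyer.Theses.CyclotomicUntwist
import Summits.BirchSwinnertonDyer.BirchSwinnertonDyer.Theorems.CyclotomicUntwistFiniteSlopeSeparatedPinnedLogNorm
import Summits.BirchSwinnertonDyer.BirchSwinnertonDyer.Theorems.CyclotomicUntwistLineCoefficients
import Summits.BirchSwinnertonDyer.BirchSwinnertonDyer.Theorems.CyclotomicUntwistPSUntwistedTraceDefs
import Summits.BirchSwinnertonDyer.BirchSwinnertonDyer.Theorems.CyclotomicUntwistDescendedFrobeniusEigenconstantCoeffs
import Literature.NumberTheory.EllipticCurves.DescendedFrobeniusMatrix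
import Summits.BirchSwinnertonDyer.BirchSwinnertonDyer.Theorems.CyclotomicUntwistPSRankOneLowerHalfAtThreeDescendedFrobenius
import HarnessLib

/-! Line `dfrob` (v4, lead bsd-line-cycu-p1 g6; v2 = S2 reshaped MODULO PRINT after cycu-p3 g7's reading; v3 = the
K2 composition `PSRankOneUpperHalfAtThree_of` added, same stubs, registered on 21581 too; v4 = S2 `stub_descendedFrobenius`
CLOSED BY IMPORT — landed verbatim by cycu-p3 g7, p629220, `Theorems/CyclotomicUntwistPSRankOneLowerHalfAtThreeDescendedFrobenius.lean`,
same namespace and name, so the composition below uses the landed theorem; after the pen's K-SEP split (route rev 5) the open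
stubs ARE route items: S1 `stub_EX` = C1 stmt-27548 `PSUntwistedLFunctionAtThree`, S4 `stub_NGZ3_dfrob` = C4 stmt-27546
`PSGrossZagierDescendedEigenlineAtThree` (deciding), S5 `stub_pBSD3_dfrob` = C5 stmt-27547 `PSpAdicBSDDescendedEigenlineAtThree` (ASIDE since
route rev 9: the families of record are the ONE-SIDED lines `dfrob_wan` on K1 / `dfrob_kato` on K2; this joint line stays as the two-sided record),
and S2a `stub_PRINT_descendedFrobenius_exists` ∧ S6 `stub_PUB` are the two PRINT inputs of C2 stmt-27549
`PSDescendedFrobeniusPrintedInputsAtThree` (texts identical by `Iff.rfl`, pen certificate cuS/SketchK2.lean); glue item 27550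
CLOSED p628024) for the deciding crux K1 `PSRankOneLowerHalfAtThree`
(stmt-BirchSwinnertonDyer-21580) of route `CyclotomicUntwist` — THE K-SEP LINE THAT CONSUMES
`WeierstrassCurve.IsDescendedFrobeniusMatrix` AT THE K1 DATUM (pen ruling bsd-wall-pss3x g4/g5, K-SEP addendum
2026-08-28T09:22Z / 10:21Z, gate (a)).

Composition = the closer of record `CyclotomicUntwistFiniteSlopeSeparatedPinnedLogNorm.
psRankOne_halves_of_separated_pin_intrinsic_sigmaLine_log_norm` (p619715: K1 ∧ K2 ⟸ PUB + EX′(a_w, ϖ) +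
N-GZ₃′ + pBSD₃′ with D5 = σ-line height, numbers `(c₀, a, b)`) over the COEFFICIENT PACKAGE of
`CyclotomicUntwistLineCoefficients` (`K = ℚ₃(ζ₃)`, the line `ψ` with `ψ(2) = ζ₃`, its conjugation `σ`, an
embedding `ι : K ↪ ℂ₃`), with the D5 numbers NO LONGER FREE: `c₀ := 0` and `(a, b)` = the coordinates in the
basis `(1, ζ₃)` of the EIGENLINE CONSTANT `c(α) = (M₀₀ + α − tr M)/M₁₀` of THE descended Frobenius matrix `M`
(`IsDescendedFrobeniusMatrix W M`, unique by `IsDescendedFrobeniusMatrix.unique`; dictionary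
`CyclotomicUntwistDescendedFrobeniusEigenline`, audit GZ3-CONSTANT-AUDIT-v1-ADDENDUM-1 §3) at the admissible
root `α` of EX′. Stubs (7 registered; S2 and S3 LANDED ⇒ 5 open: S1, S2a, S4, S5, S6 — three research items + two print inputs):
* `stub_EX` — EX′ with `aw := psUntwistedTrace` (text of record; D1 existence + rationality; RESEARCH);
* `stub_PRINT_descendedFrobenius_exists` — the Literature named fact `isDescendedFrobeniusMatrix_exists` BY NAME
  (print input); `stub_descendedFrobenius` — GIVEN that fact, on the principal-series rows: `∃ M,
  IsDescendedFrobeniusMatrix W M ∧ tr M = psUntwistedTrace W ∧ M₁₀ ≠ 0` (kernel modulo print, size M: a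
  `NineGoodModel` over `𝓞_{ℚ₃(ζ₉)}` from the GNineCriterion recipes + a reduction map + cycu-p3's LAW (N);
  reduction `CyclotomicUntwistDescendedFrobeniusOfGoodModel.stub_descendedFrobenius_of`);
* `stub_eigenconstant_coeffs` — KERNEL (size S): for `det M = 3`, `tr M ∈ {0, ±3}`, `M₁₀ ≠ 0` and a root `α`
  of `X² − (tr M)X + 3` in `ℂ₃`: `∃ a b : ℚ₃, b ≠ 0 ∧ (a + b·ι(ψ 2))·M₁₀ = M₀₀ + (α − tr M)` (`α ∈ ℚ₃(ζ₃)`);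
* `stub_NGZ3_dfrob`, `stub_pBSD3_dfrob` — the texts of record N-GZ₃′ / pBSD₃′ re-quantified `∀ M,
  IsDescendedFrobeniusMatrix W M → ∀ a b, b ≠ 0 → dictionary(M, α, a, b) → ∀ Dh, σ-line spec(0, a, b) → …`
  (RESEARCH cruxes: the 3-adic Gross–Zagier formula at slope 1/2 for `(E, η)` read on the `ψ`-eigenline height,
  and the `3`-adic BSD leading-term identity; nothing `∃`-quantified over numbers — guard p618360 respected);
* `stub_PUB` — `PublishedInputGZK` (item 19921 by name).
The composition is sorry-free; BSD is not proved by this file and no stub is. -/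

set_option linter.dupNamespace false
set_option autoImplicit false
noncomputable section
open scoped Classical MatrixGroups
open CongruenceSubgroup WeierstrassCurve WeierstrassCurve.Affine.Point Literature.NumberTheory.EllipticCurves
  Literature.NumberTheory.EllipticCurves.ModularForms Literature.NumberTheory.EllipticCurves.Rank1Residual
  Literature.NumberTheory.IwasawaTheory Summit.BirchSwinnertonDyer.Rank1Residual.Additive
  Summit.BirchSwinnertonDyer.BirchSwinnertonDyer.Theses.CyclotomicUntwist
  Summit.BirchSwinnertonDyer.BirchSwinnertonDyer.Theorems.CyclotomicUntwistFiniteSlopeSeparatedPinnedLogNorm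
  Summit.BirchSwinnertonDyer.BirchSwinnertonDyer.Theorems.PSLineCoefficients
  IsCyclotomicExtension

namespace Summit.BirchSwinnertonDyer.BirchSwinnertonDyer.Cruxes.PSRankOneLowerHalfAtThree.DFrob

/-- stub S1 = EX′ with `aw := psUntwistedTrace` (text of record of the separated split; RESEARCH, size XL: D1 —
existence of the untwisted 3-adic L-function `𝓛` of `W` with intrinsic admissibility `α² − a_w·α + 3 = 0`, the
period clause `ϖ·Ω_E = Ω⁺_f`, and the rationality `L'(E,1) = q·Ω_E·Reg_∞`). -/
theorem stub_EX :
    ∀ (W : WeierstrassCurve ℚ) [W.IsElliptic] [W.IsGloballyMinimal], ¬ W.HasCM →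
      Summit.BirchSwinnertonDyer.Rank1Residual.Additive.ClassO6 W 3 → Surj W 3 →
      Even (padicValInt 3 W.minimalDiscriminantInt) →
      W.minimalDiscriminantInt / 3 ^ padicValInt 3 W.minimalDiscriminantInt % 3 = 1 →
      W.analyticRank = 1 →
      (∃ (η : DirichletCharacter ℂ_[3] (3 ^ 2)) (α : ℂ_[3]) (𝓛 : (n : ℕ) → ZMod (3 ^ n) → ℂ_[3]) (ϖ : ℚ),
          η.IsPrimitive ∧ α ^ 2 - ((W.psUntwistedTrace : ℤ) : ℂ_[3]) * α + 3 = 0 ∧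
          IsPSCyclotomicLFunctionOf W η α 𝓛 ∧
          (∀ {N : ℕ} [NeZero N] (f : CuspForm (Gamma0 N) 2), IsNewformOf W f →
            (ϖ : ℝ) * W.realPeriodRat = plusPeriod f)) ∧
        ∃ q : ℚ, W.leadingLCoeff = (((q : ℝ) * W.realPeriodRat * W.regulator : ℝ) : ℂ) := by
  sorry

/-- stub S2a = PRINT: the existence fact for the descended Frobenius matrix (Berthelot–Ogus (2.4)/(3.14) +
Katz 5.1.4/5.3.3/5.7.2 + Katz–Messing), the Literature named fact `WeierstrassCurve.isDescendedFrobeniusMatrix_exists`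
BY NAME (cite-level input, like `stub_PUB`; closing it = accepting the print input / discharging the fact). -/
theorem stub_PRINT_descendedFrobenius_exists : isDescendedFrobeniusMatrix_exists := by
  sorry

/-! stub S2 (`stub_descendedFrobenius`: GIVEN the existence fact, THE descended Frobenius matrix on the principal-series rows
with `tr M = a_w(W)` and `M₁₀ ≠ 0`) is CLOSED: landed VERBATIM (same namespace, same name, registered signature) by cycu-p3 g7 as
`Theorems/CyclotomicUntwistPSRankOneLowerHalfAtThreeDescendedFrobenius.lean` (p629220; (B1) explicit good models over
`𝓞_{ℚ₃(ζ₉)}` with special-fibre trace `psUntwistedTrace` p627014/p627422, (B2) the reduction map `NineIntegers.nonempty_residueMap`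
(cycu-p4 g7), `IsDescendedFrobeniusMatrix.trace_eq` / `entry_one_zero_ne_zero`), imported above and used by name below. -/

/-! stub S3 (`stub_eigenconstant_coeffs`: the eigenline constant lies in `ℚ₃ ⊕ ℚ₃·ζ₃` with non-zero
`ζ₃`-coordinate) is CLOSED: the landed theorem
`Summit.BirchSwinnertonDyer.BirchSwinnertonDyer.Theorems.PSDescendedFrobeniusEigenconstantCoeffs.eigenconstant_coeffs`
(`Theorems/CyclotomicUntwistDescendedFrobeniusEigenconstantCoeffs.lean`, cycu-p1 g5, p625113, the registered signature
verbatim, 0 sorry) is imported above and used by name in the composition below. -/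

/-- stub S4 = N-GZ₃′ AT THE DESCENDED-FROBENIUS EIGENLINE (RESEARCH crux, size XL: the 3-adic Gross–Zagier
formula at slope 1/2 with nebentypus at 3, normed, for the height of the `ψ`-eigenline of `φ_W`): the text of
record N-GZ₃′ `‖c₁(𝓛)·ϖ‖·‖log₃γ‖ = ‖9η(−1)/α²‖·‖q‖₃·‖ι h_ψ(P,P)‖`, re-quantified `∀ M, IsDescendedFrobeniusMatrix
W M →` `∀ a b` subject to the eigenline dictionary `(a + b·ψ(2))·M₁₀ = M₀₀ + α − tr M`, `∀ Dh` = the σ-line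
height with numbers `(c₀, a, b) = (0, a, b)` on the lines `ψ, ψ̄` (deep admissible locus). Coefficient data:
`K = ℚ₃(ζ₃)`, `ψ(2) = ζ₃`, `ι : K ↪ ℂ₃`. -/
theorem stub_NGZ3_dfrob :
    ∀ (ψ : DirichletCharacter (CyclotomicField 3 ℚ_[3]) 9)
      (ι : CyclotomicField 3 ℚ_[3] →ₐ[ℚ_[3]] ℂ_[3]),
      ψ (2 : ZMod 9) = zeta 3 ℚ_[3] (CyclotomicField 3 ℚ_[3]) → Function.Injective ι →
    ∀ (W : WeierstrassCurve ℚ) [W.IsElliptic] [W.IsGloballyMinimal], ¬ W.HasCM →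
      Summit.BirchSwinnertonDyer.Rank1Residual.Additive.ClassO6 W 3 → Surj W 3 →
      Even (padicValInt 3 W.minimalDiscriminantInt) →
      W.minimalDiscriminantInt / 3 ^ padicValInt 3 W.minimalDiscriminantInt % 3 = 1 →
      W.analyticRank = 1 →
      ∀ (η : DirichletCharacter ℂ_[3] (3 ^ 2)) (α : ℂ_[3]) (𝓛 : (n : ℕ) → ZMod (3 ^ n) → ℂ_[3]) (ϖ : ℚ),
        η.IsPrimitive → α ^ 2 - ((W.psUntwistedTrace : ℤ) : ℂ_[3]) * α + 3 = 0 →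
        IsPSCyclotomicLFunctionOf W η α 𝓛 →
        (∀ {N : ℕ} [NeZero N] (f : CuspForm (Gamma0 N) 2), IsNewformOf W f →
          (ϖ : ℝ) * W.realPeriodRat = plusPeriod f) →
      ∀ (M : Matrix (Fin 2) (Fin 2) ℚ_[3]), W.IsDescendedFrobeniusMatrix M →
      ∀ (a b : ℚ_[3]), b ≠ 0 →
        (algebraMap ℚ_[3] ℂ_[3] a + algebraMap ℚ_[3] ℂ_[3] b * ι (ψ 2)) * algebraMap ℚ_[3] ℂ_[3] (M 1 0) =
          algebraMap ℚ_[3] ℂ_[3] (M 0 0) + (α - algebraMap ℚ_[3] ℂ_[3] M.trace) →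
      ∀ Dh : W.PSLineHeightData (CyclotomicField 3 ℚ_[3]),
        (∀ χ : DirichletCharacter (CyclotomicField 3 ℚ_[3]) 9, (χ = ψ ∨ χ = ψ⁻¹) →
          ∀ {x y : ℚ} (hxy : W.toAffine.Nonsingular x y),
            1 < ‖(x : ℚ_[3])‖ → ‖(-(x : ℚ_[3]) / (y : ℚ_[3]))‖ ≤ ((3 : ℝ)⁻¹) ^ 3 →
              (∀ ℓ : ℕ, ℓ.Prime → W.HasNonsingularReductionAt ℓ x y) →
                Dh.pairing χ (.some x y hxy) (.some x y hxy) =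
                  algebraMap ℚ_[3] (CyclotomicField 3 ℚ_[3]) (CensusX42.sigmaHeight W 3
                      ((W.baseChange ℚ_[3]).formalSigma 0) (.some x y hxy)) +
                    (algebraMap ℚ_[3] (CyclotomicField 3 ℚ_[3]) a +
                        algebraMap ℚ_[3] (CyclotomicField 3 ℚ_[3]) b * χ 2) *
                      algebraMap ℚ_[3] (CyclotomicField 3 ℚ_[3])
                        (padicEval (W.baseChange ℚ_[3]).formalLog (-(x : ℚ_[3]) / (y : ℚ_[3]))) ^ 2) →
      ∀ P : W.toAffine.Point, canonicalHeight P = W.regulator →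
      ∀ q : ℚ, W.leadingLCoeff = (((q : ℝ) * W.realPeriodRat * W.regulator : ℝ) : ℂ) →
        ‖gammaMahlerCoeff 3 𝓛 1 * (ϖ : ℂ_[3])‖ *
            ‖algebraMap ℚ_[3] ℂ_[3] (padicLog 3 ((cyclotomicGenerator 3 : ℕ) : ℚ_[3]))‖ =
          ‖(9 * η (-1) / α ^ 2 : ℂ_[3])‖ * ‖(q : ℂ_[3])‖ * ‖ι (Dh.pairing ψ P P)‖ := by
  sorry

/-- stub S5 = pBSD₃′ AT THE DESCENDED-FROBENIUS EIGENLINE (RESEARCH crux, size XL: the `3`-adic BSD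
leading-term identity, normed, on the `ψ`-eigenline height): text of record pBSD₃′ `‖c₁(𝓛)·ϖ‖·‖log₃γ‖ =
‖9η(−1)/α²‖·‖#Ш·∏c_ℓ/#tors²‖₃·‖ι h_ψ(P,P)‖`, same re-quantification as S4. -/
theorem stub_pBSD3_dfrob :
    ∀ (ψ : DirichletCharacter (CyclotomicField 3 ℚ_[3]) 9)
      (ι : CyclotomicField 3 ℚ_[3] →ₐ[ℚ_[3]] ℂ_[3]),
      ψ (2 : ZMod 9) = zeta 3 ℚ_[3] (CyclotomicField 3 ℚ_[3]) → Function.Injective ι →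
    ∀ (W : WeierstrassCurve ℚ) [W.IsElliptic] [W.IsGloballyMinimal], ¬ W.HasCM →
      Summit.BirchSwinnertonDyer.Rank1Residual.Additive.ClassO6 W 3 → Surj W 3 →
      Even (padicValInt 3 W.minimalDiscriminantInt) →
      W.minimalDiscriminantInt / 3 ^ padicValInt 3 W.minimalDiscriminantInt % 3 = 1 →
      W.analyticRank = 1 →
      ∀ (η : DirichletCharacter ℂ_[3] (3 ^ 2)) (α : ℂ_[3]) (𝓛 : (n : ℕ) → ZMod (3 ^ n) → ℂ_[3]) (ϖ : ℚ),
        η.IsPrimitive → α ^ 2 - ((W.psUntwistedTrace : ℤ) : ℂ_[3]) * α + 3 = 0 →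
        IsPSCyclotomicLFunctionOf W η α 𝓛 →
        (∀ {N : ℕ} [NeZero N] (f : CuspForm (Gamma0 N) 2), IsNewformOf W f →
          (ϖ : ℝ) * W.realPeriodRat = plusPeriod f) →
      ∀ (M : Matrix (Fin 2) (Fin 2) ℚ_[3]), W.IsDescendedFrobeniusMatrix M →
      ∀ (a b : ℚ_[3]), b ≠ 0 →
        (algebraMap ℚ_[3] ℂ_[3] a + algebraMap ℚ_[3] ℂ_[3] b * ι (ψ 2)) * algebraMap ℚ_[3] ℂ_[3] (M 1 0) =
          algebraMap ℚ_[3] ℂ_[3] (M 0 0) + (α - algebraMap ℚ_[3] ℂ_[3] M.trace) →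
      ∀ Dh : W.PSLineHeightData (CyclotomicField 3 ℚ_[3]),
        (∀ χ : DirichletCharacter (CyclotomicField 3 ℚ_[3]) 9, (χ = ψ ∨ χ = ψ⁻¹) →
          ∀ {x y : ℚ} (hxy : W.toAffine.Nonsingular x y),
            1 < ‖(x : ℚ_[3])‖ → ‖(-(x : ℚ_[3]) / (y : ℚ_[3]))‖ ≤ ((3 : ℝ)⁻¹) ^ 3 →
              (∀ ℓ : ℕ, ℓ.Prime → W.HasNonsingularReductionAt ℓ x y) →
                Dh.pairing χ (.some x y hxy) (.some x y hxy) =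
                  algebraMap ℚ_[3] (CyclotomicField 3 ℚ_[3]) (CensusX42.sigmaHeight W 3
                      ((W.baseChange ℚ_[3]).formalSigma 0) (.some x y hxy)) +
                    (algebraMap ℚ_[3] (CyclotomicField 3 ℚ_[3]) a +
                        algebraMap ℚ_[3] (CyclotomicField 3 ℚ_[3]) b * χ 2) *
                      algebraMap ℚ_[3] (CyclotomicField 3 ℚ_[3])
                        (padicEval (W.baseChange ℚ_[3]).formalLog (-(x : ℚ_[3]) / (y : ℚ_[3]))) ^ 2) →
      ∀ P : W.toAffine.Point, canonicalHeight P = W.regulator →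
        ‖gammaMahlerCoeff 3 𝓛 1 * (ϖ : ℂ_[3])‖ *
            ‖algebraMap ℚ_[3] ℂ_[3] (padicLog 3 ((cyclotomicGenerator 3 : ℕ) : ℚ_[3]))‖ =
          ‖(9 * η (-1) / α ^ 2 : ℂ_[3])‖ *
          ‖(((W.shaOrder : ℚ) * (W.tamagawaProduct : ℚ) / (W.torsionOrder : ℚ) ^ 2 : ℚ) : ℂ_[3])‖ *
          ‖ι (Dh.pairing ψ P P)‖ := by
  sorry

/-- stub S6 = PUB: Gross–Zagier–Kolyvagin (route support item 19921 `PublishedInputGZK`, by name). -/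
theorem stub_PUB : PublishedInputGZK := by
  sorry

/-! ### Composition (sorry-free) -/

/-- `((a_w : ℤ) : ℂ₃) = algebraMap ℚ₃ ℂ₃ ((a_w : ℤ) : ℚ₃)` (cast bookkeeping). -/
theorem intCast_eq_algebraMap (n : ℤ) : ((n : ℤ) : ℂ_[3]) = algebraMap ℚ_[3] ℂ_[3] (n : ℚ_[3]) := by
  rw [map_intCast]

/-- COMPOSITION CORE (line `dfrob`, lead bsd-line-cycu-p1 g5): **K1 ∧ K2** from the registered stubs (S3 landed,
p625113) — the closer of record `psRankOne_halves_of_separated_pin_intrinsic_sigmaLine_log_norm` over the coefficient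
package `(ℚ₃(ζ₃), ψ, σ, ι)` with `aw := psUntwistedTrace`, `c₀ := 0` and the D5 numbers `(a, b)` CHOSEN (per `(W, α)`) as
the `(1, ζ₃)`-coordinates of the eigenline constant of THE descended Frobenius matrix (`stub_descendedFrobenius` under the
print stub, `eigenconstant_coeffs`; canonical by `IsDescendedFrobeniusMatrix.unique`), so that the `∀ M ∀ a b`-quantified
research stubs S4/S5 apply. Sorry-free. -/
theorem psRankOne_halves_of : PSRankOneLowerHalfAtThree ∧ PSRankOneUpperHalfAtThree := by
  -- the coefficient package
  obtain ⟨ψ, σ, hψ2, hψ3, hψ1, hσ⟩ := exists_line_and_conjugation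
  obtain ⟨ι, hι⟩ := exists_algHom_padicComplex_injective
  -- the eigenline dictionary as a predicate on pairs `(a, b)`
  let Good : (W : WeierstrassCurve ℚ) → ℂ_[3] → ℚ_[3] × ℚ_[3] → Prop := fun W α ab =>
    ab.2 ≠ 0 ∧ ∀ M : Matrix (Fin 2) (Fin 2) ℚ_[3], W.IsDescendedFrobeniusMatrix M →
      (algebraMap ℚ_[3] ℂ_[3] ab.1 + algebraMap ℚ_[3] ℂ_[3] ab.2 * ι (ψ 2)) * algebraMap ℚ_[3] ℂ_[3] (M 1 0) =
        algebraMap ℚ_[3] ℂ_[3] (M 0 0) + (α - algebraMap ℚ_[3] ℂ_[3] M.trace)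
  -- the D5 numbers by choice (junk `(0, 1)` off the locus where the dictionary applies)
  let ab : (W : WeierstrassCurve ℚ) → DirichletCharacter ℂ_[3] (3 ^ 2) → ℂ_[3] → ℚ_[3] × ℚ_[3] :=
    fun W _ α => if h : ∃ p : ℚ_[3] × ℚ_[3], Good W α p then h.choose else (0, 1)
  have hb : ∀ W η α, (ab W η α).2 ≠ 0 := by
    intro W η α
    show (if h : ∃ p : ℚ_[3] × ℚ_[3], Good W α p then h.choose else ((0 : ℚ_[3]), (1 : ℚ_[3]))).2 ≠ 0
    split_ifs with h
    · exact h.choose_spec.1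
    · exact one_ne_zero
  have hgood : ∀ W η α, (∃ p : ℚ_[3] × ℚ_[3], Good W α p) → Good W α (ab W η α) := by
    intro W η α h
    show Good W α (if h : ∃ p : ℚ_[3] × ℚ_[3], Good W α p then h.choose else ((0 : ℚ_[3]), (1 : ℚ_[3])))
    rw [dif_pos h]
    exact h.choose_spec
  -- on a principal-series row the dictionary applies at the admissible root `α`
  have hrow : ∀ (W : WeierstrassCurve ℚ) [W.IsElliptic] [W.IsGloballyMinimal],
      Summit.BirchSwinnertonDyer.Rank1Residual.Additive.ClassO6 W 3 →
      Even (padicValInt 3 W.minimalDiscriminantInt) →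
      W.minimalDiscriminantInt / 3 ^ padicValInt 3 W.minimalDiscriminantInt % 3 = 1 →
      ∀ (η : DirichletCharacter ℂ_[3] (3 ^ 2)) (α : ℂ_[3]),
        α ^ 2 - ((W.psUntwistedTrace : ℤ) : ℂ_[3]) * α + 3 = 0 →
        ∃ M : Matrix (Fin 2) (Fin 2) ℚ_[3], W.IsDescendedFrobeniusMatrix M ∧ Good W α (ab W η α) := by
    intro W _ _ hO6 hev hsq η α hroot
    obtain ⟨M, hM, htr, hγ⟩ := stub_descendedFrobenius stub_PRINT_descendedFrobenius_exists W hO6 hev hsq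
    have htr' : M.trace = 0 ∨ M.trace = 3 ∨ M.trace = -3 := by
      rcases Summit.BirchSwinnertonDyer.BirchSwinnertonDyer.Theorems.PSUntwistedTrace.psUntwistedTrace_eq_or W
        with h | h | h
      · exact Or.inl (by rw [htr, h]; push_cast; rfl)
      · exact Or.inr (Or.inl (by rw [htr, h]; push_cast; rfl))
      · exact Or.inr (Or.inr (by rw [htr, h]; push_cast; rfl))
    have hroot' : α ^ 2 - algebraMap ℚ_[3] ℂ_[3] M.trace * α + 3 = 0 := by
      rw [htr, ← intCast_eq_algebraMap]; exact hroot
    obtain ⟨a, b, hb0, hdict⟩ :=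
      Summit.BirchSwinnertonDyer.BirchSwinnertonDyer.Theorems.PSDescendedFrobeniusEigenconstantCoeffs.eigenconstant_coeffs
        ψ ι hψ2 hι M α hM.det_eq htr' hγ hroot'
    refine ⟨M, hM, hgood W η α ⟨(a, b), hb0, fun M' hM' => ?_⟩⟩
    rw [hM'.unique hM]
    exact hdict
  -- the closer of record
  have H := psRankOne_halves_of_separated_pin_intrinsic_sigmaLine_log_norm (R := CyclotomicField 3 ℚ_[3])
    ι hι ψ σ hσ ⟨hψ3, hψ1⟩ (fun _ _ _ => (0 : ℚ_[3])) (fun W η α => (ab W η α).1) (fun W η α => (ab W η α).2)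
    (fun _ _ _ => by rw [norm_zero]; exact zero_le_one) hb
    (fun W η α Dh => ∀ χ : DirichletCharacter (CyclotomicField 3 ℚ_[3]) 9, (χ = ψ ∨ χ = ψ⁻¹) →
      ∀ {x y : ℚ} (hxy : W.toAffine.Nonsingular x y),
        1 < ‖(x : ℚ_[3])‖ → ‖(-(x : ℚ_[3]) / (y : ℚ_[3]))‖ ≤ ((3 : ℝ)⁻¹) ^ 3 →
          (∀ ℓ : ℕ, ℓ.Prime → W.HasNonsingularReductionAt ℓ x y) →
            Dh.pairing χ (.some x y hxy) (.some x y hxy) =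
              algebraMap ℚ_[3] (CyclotomicField 3 ℚ_[3]) (CensusX42.sigmaHeight W 3
                  ((W.baseChange ℚ_[3]).formalSigma 0) (.some x y hxy)) +
                (algebraMap ℚ_[3] (CyclotomicField 3 ℚ_[3]) (ab W η α).1 +
                    algebraMap ℚ_[3] (CyclotomicField 3 ℚ_[3]) (ab W η α).2 * χ 2) *
                  algebraMap ℚ_[3] (CyclotomicField 3 ℚ_[3])
                    (padicEval (W.baseChange ℚ_[3]).formalLog (-(x : ℚ_[3]) / (y : ℚ_[3]))) ^ 2)
    (fun W _ _ η α Dh => by simp only [_root_.map_zero, sub_zero])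
    (fun W => W.psUntwistedTrace) stub_PUB stub_EX ?_ ?_
  · exact H
  · -- N-GZ₃′ from S4 at THE matrix and the chosen numbers
    intro W _ _ hCM hO6 hsurj hev hsq hr η α 𝓛 ϖ hη hroot hμ hϖ Dh hDh P hP q hL
    obtain ⟨M, hM, hb0, hdict⟩ := hrow W hO6 hev hsq η α hroot
    exact stub_NGZ3_dfrob ψ ι hψ2 hι W hCM hO6 hsurj hev hsq hr η α 𝓛 ϖ hη hroot hμ hϖ M hM
      (ab W η α).1 (ab W η α).2 hb0 (hdict M hM) Dh hDh P hP q hL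
  · -- pBSD₃′ from S5
    intro W _ _ hCM hO6 hsurj hev hsq hr η α 𝓛 ϖ hη hroot hμ hϖ Dh hDh P hP
    obtain ⟨M, hM, hb0, hdict⟩ := hrow W hO6 hev hsq η α hroot
    exact stub_pBSD3_dfrob ψ ι hψ2 hι W hCM hO6 hsurj hev hsq hr η α 𝓛 ϖ hη hroot hμ hϖ M hM
      (ab W η α).1 (ab W η α).2 hb0 (hdict M hM) Dh hDh P hP

/-- COMPOSITION for crux K1 (stmt-BirchSwinnertonDyer-21580): `PSRankOneLowerHalfAtThree` BY NAME. Sorry-free. -/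
theorem PSRankOneLowerHalfAtThree_of : PSRankOneLowerHalfAtThree := psRankOne_halves_of.1

/-- COMPOSITION for crux K2 (stmt-BirchSwinnertonDyer-21581): `PSRankOneUpperHalfAtThree` BY NAME from the SAME stubs
(the closer of record proves both halves at once). Sorry-free. -/
theorem PSRankOneUpperHalfAtThree_of : PSRankOneUpperHalfAtThree := psRankOne_halves_of.2

end Summit.BirchSwinnertonDyer.BirchSwinnertonDyer.Cruxes.PSRankOneLowerHalfAtThree.DFrob
end
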